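import Summits.QuantumFields.QCD.Theorems.SpectralDefectExtinctionChiralDescentStubFermiBoltzmannPolynomialInMass
import Literature.MathematicalPhysics.QuantumFieldTheory.QCDPhaseQuenched
import Literature.MathematicalPhysics.QuantumLattice.GrassmannCoefficientRegularity
import Literature.MathematicalPhysics.QuantumFieldTheory.QCDSiteReflectionPositivityProofs
import HarnessLib

/-!
# Every finite-torus lattice-QCD functional is a polynomial in the bare quark masses

Stub `stub_torusFunctionalPolynomialInMass` (W1; H1 engine, step 2) of the line `Sketch` (infimum
descent) for the crux `SpectralDefectExtinction.ChiralDescent`.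

For a coefficient-regular Grassmann-valued observable `X(U)` of the `SU(3)` gauge field on the
four-torus of side `S`, the un-normalised functional
`m ↦ ∫ dμ_W(U) ∫ dψ̄ dψ X(U) e^{−ψ̄ D(U, m) ψ}` is a polynomial in the mass tuple `m = (m_f)_f`,
of partial degree at most the number of quark variables.  Proof: the landed brick
`stub_fermiBoltzmannPolynomialInMass` expands `e^{−ψ̄D(U,m)ψ} = Σ_α (∏_f m_f^{α_f}) • Y_α(U)`
with `Y_α(U) = e^{−ψ̄D(U,0)ψ} · Z_α`, `Z_α` a FIXED Grassmann element; the Berezin integral is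
linear; each coefficient `U ↦ ∫dψ̄dψ X(U) Y_α(U)` is bounded and measurable (coefficient
regularity of `U ↦ X(U) e^{−ψ̄D(U,0)ψ} Z_α`: `CoeffRegular.mul`, `coeffRegular_quadratic`,
`.grassmannExp`, `.measurable_apply`, `.exists_norm_apply_le`), hence integrable against the
Wilson probability measure, and the Bochner integral commutes with the finite sum over `α`.
Everything is proved; no named fact. [folklore]
-/

noncomputable section

namespace Summit.QuantumFields.QCD.Cruxes.ChiralDescent.InfimumDescent

open Filter Topology MeasureTheory
open Literature.MathematicalPhysics.QuantumLattice Literature.MathematicalPhysics.QuantumFieldTheory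
  Literature.Probability.LatticeModels
open Literature.MathematicalPhysics.QuantumLattice.GrassmannAlgebra

variable {Nf S : ℕ} [NeZero S]

/-- The Boltzmann factor `U ↦ e^{−ψ̄D(U,m)ψ}` is coefficient-regular: the entries of `D(U, m)`
are continuous in `U`, and a quadratic form has no constant term. [folklore] -/
theorem coeffRegular_fermiBoltzmann (mq : Fin Nf → ℝ) :
    CoeffRegular (fun U : GaugeConfig 4 S ↥(Matrix.specialUnitaryGroup (Fin 3) ℂ) =>
      fermiBoltzmann U mq) := by
  unfold fermiBoltzmann
  exact (coeffRegular_quadratic fun p q =>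
    (continuous_diracMatrix mq).neg.matrix_elem p q).grassmannExp fun U => coord_empty_quadratic _

/-- A fixed linear functional of a coefficient-regular Grassmann-valued variable (bounded and
measurable) is integrable against every finite measure. [folklore] -/
theorem integrable_apply_of_coeffRegular {Ω : Type*} [MeasurableSpace Ω] {ι : Type*}
    [LinearOrder ι] [Fintype ι] {Y : Ω → GrassmannAlgebra ℂ ι} (hY : CoeffRegular Y)
    (lam : GrassmannAlgebra ℂ ι →ₗ[ℂ] ℂ) (μ : Measure Ω) [IsFiniteMeasure μ] :
    Integrable (fun ω => lam (Y ω)) μ := by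
  obtain ⟨C, hC⟩ := hY.exists_norm_apply_le lam
  exact Integrable.of_bound (hY.measurable_apply lam).aestronglyMeasurable C
    (Eventually.of_forall hC)

/-- **Linear exchange.** For coefficient-regular `X`, `Y_k` and scalars `p_k`,
`∫dμ ∫dψ̄dψ X (Σ_k p_k • Y_k) = Σ_k p_k ∫dμ ∫dψ̄dψ X Y_k`: the Berezin integral is linear and
the Bochner integral against a finite measure commutes with the finite sum of the bounded
measurable terms `U ↦ ∫dψ̄dψ X(U) Y_k(U)`. [folklore] -/
theorem integral_fermiIntegral_mul_sum_smul {K : Type*} [Fintype K]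
    (μ : Measure (GaugeConfig 4 S ↥(Matrix.specialUnitaryGroup (Fin 3) ℂ))) [IsFiniteMeasure μ]
    {X : GaugeConfig 4 S ↥(Matrix.specialUnitaryGroup (Fin 3) ℂ) → FermiAlg Nf S}
    (hX : CoeffRegular X)
    {Y : K → GaugeConfig 4 S ↥(Matrix.specialUnitaryGroup (Fin 3) ℂ) → FermiAlg Nf S}
    (hY : ∀ k, CoeffRegular (Y k)) (p : K → ℂ) :
    ∫ U, fermiIntegral (X U * ∑ k, p k • Y k U) ∂μ =
      ∑ k, p k * ∫ U, fermiIntegral (X U * Y k U) ∂μ := by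
  have h : ∀ U, fermiIntegral (X U * ∑ k, p k • Y k U) =
      ∑ k, p k * fermiIntegral (X U * Y k U) := fun U => by
    rw [Finset.mul_sum, map_sum]
    exact Finset.sum_congr rfl fun k _ => by rw [mul_smul_comm, map_smul, smul_eq_mul]
  simp_rw [h]
  rw [integral_finsetSum _ fun k _ =>
    (integrable_apply_of_coeffRegular (hX.mul (hY k)) fermiIntegral μ).const_mul (p k)]
  exact Finset.sum_congr rfl fun k _ => integral_const_mul _ _

/-- **Stub W1 — every torus functional is a polynomial in the bare masses** (H1 engine, step 2).
For a coefficient-regular Grassmann-valued observable `X` of the gauge field on the torus of side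
`S`, the un-normalised lattice functional `m ↦ ∫dμ_W(U) ∫dψ̄dψ X(U) e^{−ψ̄D(U,m)ψ}` at inverse
coupling `β` is a polynomial in the mass tuple, of partial degree at most the number of quark
variables in each `m_f`; the coefficients are `c_α = ∫dμ_W(U) ∫dψ̄dψ X(U) Y_α(U)` with
`Y_α(U) = e^{−ψ̄D(U,0)ψ} ∏_f ((−1)^{α_f}/α_f!) (ψ̄P_fψ)^{α_f}` from
`stub_fermiBoltzmannPolynomialInMass`. [folklore] -/
theorem stub_torusFunctionalPolynomialInMass :
    ∀ (Nf S : ℕ) [NeZero S] (β : ℝ)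
      (X : GaugeConfig 4 S ↥(Matrix.specialUnitaryGroup (Fin 3) ℂ) → FermiAlg Nf S),
      GrassmannAlgebra.CoeffRegular X →
      ∃ c : (Fin Nf → Fin (Fintype.card (FermiIdx Nf S) + 1)) → ℂ, ∀ mq : Fin Nf → ℝ,
        (∫ U, fermiIntegral (X U * fermiBoltzmann U mq)
            ∂(wilsonMeasure (d := 4) (L := S) (fundamentalRep (Fin 3)) β)) =
          ∑ α : Fin Nf → Fin (Fintype.card (FermiIdx Nf S) + 1),
            (∏ f, ((mq f : ℝ) : ℂ) ^ (α f : ℕ)) * c α := by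
  intro Nf S _ β X hX
  refine ⟨fun α => ∫ U, fermiIntegral (X U * (fermiBoltzmann U 0 *
      (List.ofFn fun f : Fin Nf =>
        ((-1 : ℂ) ^ (α f : ℕ) / ((α f : ℕ).factorial : ℂ)) •
          (quadratic ℂ (Matrix.reindex quarkEquiv quarkEquiv
            (Matrix.of fun v w : QuarkVar Nf S =>
              if v = w ∧ v.1 = f then (1 : ℂ) else 0))) ^ (α f : ℕ)).prod))
      ∂(wilsonMeasure (d := 4) (L := S) (fundamentalRep (Fin 3)) β), fun mq => ?_⟩
  simp_rw [stub_fermiBoltzmannPolynomialInMass Nf S _ mq]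
  refine integral_fermiIntegral_mul_sum_smul _ hX (fun α => ?_) _
  exact (coeffRegular_fermiBoltzmann 0).mul (coeffRegular_const _)

end Summit.QuantumFields.QCD.Cruxes.ChiralDescent.InfimumDescent
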